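import Summits.QuantumFields.YangMills.Theorems.F4SubCurvatureDoorFibreReductionDisintegration
import Summits.QuantumFields.YangMills.Theorems.F4SubCurvatureDoorRationalToGeneralSingleShellDichotomy
import Mathlib
import HarnessLib

/-!
# LINE g21-B «fibre dichotomy» (⟨stmt-QuantumFields-23125⟩) — B5 helper: the axis budget and Fatou's lemma make almost every
# symmetric fibre radial; radial fibres integrate to a radial kernel

Helper toward the registered stub B5 `stub_fibreReduction` (`Cruxes/RationalToGeneral/Lines/fibre_dichotomy.lean` :176).  In the abstract
disintegration package (base `η`, fibres `ν_s`):

* `ae_liminf_axis_eq_zero` — if `t⁸ ∫ e^{−tE} dμ → 0` as `t → 0⁺` (the axis budget, rung R-B5a), then for `η`-a.e. `s`,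
  `liminf_n t_n⁸ ∫ e^{−t_n E} dν_s = 0` along `t_n = 1/(n+1)` (Tonelli + Fatou `lintegral_liminf_le`; nothing can cancel in a positive measure);
* `ae_radial` — hence, given the registered stub B4 `SingleShellDichotomy` (✓ tree) and LF-symmetry of a.e. fibre, `η`-a.e. fibre transform is
  radial off the mirror (the second alternative of B4 contradicts the vanishing `liminf`);
* `kernel_eq_of_norm_eq` — a kernel that is the `η`-superposition of the fibre transforms off the mirror takes equal values at off-mirror
  points of equal norm.

Mathlib + tree only; no `sorry`; no new definitions.  HONEST LABEL: helper for a registered stub of an OPEN line; B5, S1, S2, ⟨23125⟩, ⟨23035⟩,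
R2d and the Yang–Mills mass gap remain OPEN; no summit is proved by a line.
-/

noncomputable section

open MeasureTheory MeasureTheory.Measure Set Function Filter Topology ProbabilityTheory
open scoped BigOperators ENNReal

namespace Summit.QuantumFields.YangMills.Theorems.F4SubCurvatureDoorFibreReduction

open Summit.QuantumFields.YangMills.Theorems.F4SubCurvatureDoorLaplaceFourierRegistered (E4 E3 timeSpace)
open Summit.QuantumFields.YangMills.Theorems.F4SubCurvatureDoorFibreDichotomyAxis (spacePart lfEval IsD4Isometry SymmetricLF)
open Summit.QuantumFields.YangMills.Theorems.F4SubCurvatureDoorShellLFAnalytic (massSq IsShellMeasure)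
open Summit.QuantumFields.YangMills.Theorems.F4SubCurvatureDoorSingleShellDichotomyRegistered (SingleShellDichotomy)
open Summit.QuantumFields.YangMills.Theorems.F4SubCurvatureDoorHarmonicMomentODE (lfEval_axis)

variable {μ : Measure (ℝ × E3)} {η : Measure ℝ} {ν : Kernel ℝ (ℝ × E3)}

/-! ## Fatou along `t_n = 1/(n+1)` -/

/-- The sequence `t_n = 1/(n+1)` tends to `0` from the right. -/
theorem tendsto_seq_nhdsWithin : Tendsto (fun n : ℕ => 1 / ((n : ℝ) + 1)) atTop (𝓝[>] (0 : ℝ)) := by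
  refine tendsto_nhdsWithin_iff.2 ⟨tendsto_one_div_add_atTop_nhds_zero_nat, Eventually.of_forall fun n => ?_⟩
  exact mem_Ioi.2 (by positivity)

/-- **Axis budget + Fatou**: if `t⁸ ∫ e^{−tE} dμ → 0` as `t → 0⁺`, then for `η`-a.e. `s` the scaled fibre Laplace transforms
`t_n⁸ ∫⁻ e^{−t_n E} dν_s` have vanishing `liminf` along `t_n = 1/(n+1)`. -/
theorem ae_liminf_axis_eq_zero
    (hdis : ∀ S : Set ℝ, MeasurableSet S → ∀ f : ℝ × E3 → ℝ≥0∞, Measurable f →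
      ∫⁻ p in massSq ⁻¹' S, f p ∂μ = ∫⁻ s in S, ∫⁻ p, f p ∂(ν s) ∂η)
    (hint : ∀ t : ℝ, 0 < t → Integrable (fun p : ℝ × E3 => Real.exp (-(t * p.1))) μ)
    (hbudget : Tendsto (fun t : ℝ => t ^ 8 * ∫ p : ℝ × E3, Real.exp (-(t * p.1)) ∂μ) (𝓝[>] 0) (𝓝 0)) :
    ∀ᵐ s ∂η, liminf (fun n : ℕ => ENNReal.ofReal ((1 / ((n : ℝ) + 1)) ^ 8) *
      ∫⁻ p, ENNReal.ofReal (Real.exp (-((1 / ((n : ℝ) + 1)) * p.1))) ∂(ν s)) atTop = 0 := by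
  set t : ℕ → ℝ := fun n => 1 / ((n : ℝ) + 1) with ht
  have htpos : ∀ n, 0 < t n := fun n => by simp only [ht]; positivity
  set F : ℕ → ℝ → ℝ≥0∞ := fun n s => ENNReal.ofReal (t n ^ 8) * ∫⁻ p, ENNReal.ofReal (Real.exp (-(t n * p.1))) ∂(ν s) with hF
  have hFm : ∀ n, Measurable (F n) := fun n =>
    (Measurable.lintegral_kernel (measurable_expWeight (t n))).const_mul _
  -- `∫⁻ F n dη = ofReal (t_n⁸ ∫ e^{−t_n E} dμ) → 0`
  have hlin : ∀ n, ∫⁻ s, F n s ∂η = ENNReal.ofReal (t n ^ 8 * ∫ p : ℝ × E3, Real.exp (-(t n * p.1)) ∂μ) := by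
    intro n
    obtain ⟨heq, -⟩ := lintegral_exp_fibre hdis hint (htpos n)
    rw [hF, lintegral_const_mul _ (Measurable.lintegral_kernel (measurable_expWeight (t n))), heq,
      ← ofReal_integral_eq_lintegral_ofReal (hint _ (htpos n)) (Eventually.of_forall fun p => (Real.exp_pos _).le),
      ENNReal.ofReal_mul (pow_nonneg (htpos n).le _)]
  have hlim : Tendsto (fun n => ∫⁻ s, F n s ∂η) atTop (𝓝 0) := by
    simp_rw [hlin]
    rw [← ENNReal.ofReal_zero]
    exact ENNReal.tendsto_ofReal (hbudget.comp tendsto_seq_nhdsWithin)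
  -- Fatou
  have hfatou : ∫⁻ s, liminf (fun n => F n s) atTop ∂η = 0 := by
    refine le_antisymm ?_ zero_le
    calc ∫⁻ s, liminf (fun n => F n s) atTop ∂η ≤ liminf (fun n => ∫⁻ s, F n s ∂η) atTop := lintegral_liminf_le hFm
      _ = 0 := hlim.liminf_eq
  have hae := (lintegral_eq_zero_iff (Measurable.liminf hFm)).1 hfatou
  filter_upwards [hae] with s hs
  exact hs

/-! ## Almost every fibre is radial -/

/-- **`η`-a.e. fibre transform is radial off the mirror**, given the single-shell dichotomy B4, LF-symmetry of a.e. fibre, and the axis budget: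
the growth alternative `t⁸ L_{ν_s}(t) ≥ c > 0` is incompatible with the vanishing `liminf` of `ae_liminf_axis_eq_zero`. -/
theorem ae_radial (hB4 : SingleShellDichotomy)
    (hdis : ∀ S : Set ℝ, MeasurableSet S → ∀ f : ℝ × E3 → ℝ≥0∞, Measurable f →
      ∫⁻ p in massSq ⁻¹' S, f p ∂μ = ∫⁻ s in S, ∫⁻ p, f p ∂(ν s) ∂η)
    (hfib : ∀ᵐ s ∂η, ν s {p | massSq p ≠ s} = 0) (hcone : ∀ᵐ s ∂η, ν s {p | p.1 < ‖p.2‖} = 0)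
    (hint : ∀ t : ℝ, 0 < t → Integrable (fun p : ℝ × E3 => Real.exp (-(t * p.1))) μ)
    (hsymm : ∀ᵐ s ∂η, SymmetricLF (ν s))
    (hbudget : Tendsto (fun t : ℝ => t ^ 8 * ∫ p : ℝ × E3, Real.exp (-(t * p.1)) ∂μ) (𝓝[>] 0) (𝓝 0)) :
    ∀ᵐ s ∂η, ∃ g₀ : ℝ → ℝ, ∀ x : E4, x 0 ≠ 0 → lfEval (ν s) x = g₀ (‖x‖ ^ 2) := by
  filter_upwards [ae_isShellMeasure hdis hfib hcone hint, hsymm, ae_liminf_axis_eq_zero hdis hint hbudget] with s hshell hsym hlim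
  rcases hB4 (ν s) s hshell hsym with hrad | ⟨c, hc, t₀, ht₀, hgrow⟩
  · exact hrad
  · exfalso
    -- along the sequence the scaled transforms stay above `c`
    set t : ℕ → ℝ := fun n => 1 / ((n : ℝ) + 1) with ht
    have htpos : ∀ n, 0 < t n := fun n => by simp only [ht]; positivity
    have hev : ∀ᶠ n : ℕ in atTop, ENNReal.ofReal c ≤
        ENNReal.ofReal (t n ^ 8) * ∫⁻ p, ENNReal.ofReal (Real.exp (-(t n * p.1))) ∂(ν s) := by
      have hsmall : ∀ᶠ n : ℕ in atTop, t n < t₀ :=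
        (tendsto_one_div_add_atTop_nhds_zero_nat.eventually (gt_mem_nhds ht₀))
      filter_upwards [hsmall] with n hn
      have hL : ∫⁻ p, ENNReal.ofReal (Real.exp (-(t n * p.1))) ∂(ν s) = ENNReal.ofReal (lfEval (ν s) (timeSpace (t n) 0)) := by
        rw [lfEval_axis (htpos n), ofReal_integral_eq_lintegral_ofReal (hshell.2.2 _ (htpos n))
          (Eventually.of_forall fun p => (Real.exp_pos _).le)]
      rw [hL, ← ENNReal.ofReal_mul (pow_nonneg (htpos n).le _)]
      exact ENNReal.ofReal_le_ofReal (hgrow (t n) (htpos n) hn)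
    have hge : ENNReal.ofReal c ≤ liminf (fun n : ℕ => ENNReal.ofReal (t n ^ 8) *
        ∫⁻ p, ENNReal.ofReal (Real.exp (-(t n * p.1))) ∂(ν s)) atTop := le_liminf_of_le (by isBoundedDefault) hev
    rw [hlim] at hge
    have : ENNReal.ofReal c = 0 := le_antisymm hge zero_le
    rw [ENNReal.ofReal_eq_zero] at this
    linarith

/-! ## Integrating radial fibres back -/

/-- **Radial fibres integrate to a radial kernel (off the mirror).**  If `K(x) = ∫ lfEval ν_s x dη(s)` whenever `x₀ ≠ 0` and a.e. fibre transform
is radial off the mirror, then `K x = K y` for off-mirror `x, y` of equal norm. -/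
theorem kernel_eq_of_norm_eq {K : E4 → ℝ} (hK : ∀ x : E4, x 0 ≠ 0 → K x = ∫ s, lfEval (ν s) x ∂η)
    (hrad : ∀ᵐ s ∂η, ∃ g₀ : ℝ → ℝ, ∀ x : E4, x 0 ≠ 0 → lfEval (ν s) x = g₀ (‖x‖ ^ 2))
    {x y : E4} (hx : x 0 ≠ 0) (hy : y 0 ≠ 0) (hxy : ‖x‖ = ‖y‖) : K x = K y := by
  rw [hK x hx, hK y hy]
  refine integral_congr_ae ?_
  filter_upwards [hrad] with s ⟨g₀, hg⟩
  rw [hg x hx, hg y hy, hxy]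

end Summit.QuantumFields.YangMills.Theorems.F4SubCurvatureDoorFibreReduction

end
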